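import Mathlib
import HarnessLib
import Summits.CriticalPhenomena.Ising3DConformalLimit.Theses.MirrorHoelderCompactness
import Summits.CriticalPhenomena.Ising3DConformalLimit.Theorems.HyperoctahedralRPExistsScaleCovariantLimitNonSeparableModulusOfUniformRegularity
import Summits.CriticalPhenomena.Ising3DConformalLimit.Theorems.HyperoctahedralRPExistsScaleCovariantLimitCompactnessItemMapsDoubling
import Summits.CriticalPhenomena.Ising3DConformalLimit.Theorems.MoebiusLimitExists.Negative.PinnedClusterPoints
import Summits.CriticalPhenomena.Ising3DConformalLimit.Theorems.MirrorHoelderCompactnessCompactnessGlueTwoPoint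
import Summits.CriticalPhenomena.Ising3DConformalLimit.Cruxes.NonSeparableModulus.Lines.birth

/-!
# Skeleton vet, crux stmt-CriticalPhenomena-6152 `NonSeparableModulus` — stub 2 alone carries the line

Evidence file (refuter-skel-stmt-CriticalPhenomena-6152-vet-0, 2026-08-17). Imports = the birth
skeleton's own imports + the landed glue file `MirrorHoelderCompactnessCompactnessGlueTwoPoint`
(axis monotonicity / comparable scales). The skeleton `Lines/birth.lean` is NOT imported; its two
stub statements are copied verbatim below.

Shown, sorry-free:
* `twoPointDoubling_of_pinningRatioBound`  : stub 2 ⟹ item 6150 (`TwoPointDoubling`);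
* `pinningRatioBound_of_twoPointDoubling`  : item 6150 ⟹ stub 2 — so stub 2 ⟺ the route's own
  rank-2 crux 6150 (a renamed existing OPEN ITEM, as the planner says: "6150 in mesh clothes");
* `nonSeparableModulus_of_pinningRatioBound` : stub 2 ALONE ⟹ the crux (via the landed
  `uniformRegularity_of_doubling` 6150 ⟹ 4658 and `stub_nonSeparableModulus_of_uniformRegularity`
  4658 ⟹ 6152);
* `coarseScaleModulus_of_pinningRatioBound` : stub 2 ALONE ⟹ stub 1.
Hence in `NonSeparableModulus_of h1 h2` the hypothesis `h1 : stub_coarseScaleModulus` is not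
load-bearing: the registered line is logically `crux ⟸ stub 2 ≡ item 6150`, i.e. the status quo
already recorded in the tree (birth.lean §5), with stub 1 a consequence riding along.
-/

noncomputable section

namespace SkelVet6152R

open Literature.Probability.LatticeModels Filter Set
open Summit.CriticalPhenomena.Ising3DConformalLimit.Theses.MirrorHoelderCompactness
open Summit.CriticalPhenomena.Ising3DConformalLimit.MirrorHoelderCompactnessGlue
  (criticalTwoPoint_axis_antitone criticalTwoPoint_axis_comparable)
open Summit.CriticalPhenomena.Ising3DConformalLimit.PinnedClusterPoints (criticalTwoPoint_pos3)
open Summit.CriticalPhenomena.Ising3DConformalLimit.Cruxes.ExistsScaleCovariantLimit.TwoHierarchies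

/-- verbatim copy of `Birth.CoarseScaleModulus` (stub 1 statement). -/
def CoarseScaleModulus : Prop :=
  ∀ (n : ℕ) (K : Set (Fin n → EuclideanSpace ℝ (Fin 3))), K ⊆ NonCoincident 3 n → IsCompact K →
    ∃ Λ₀ : ℝ, 0 < Λ₀ ∧ ∀ Λ : ℝ, Λ₀ ≤ Λ → ∀ ε : ℝ, 0 < ε → ∃ r δ₀ : ℝ, 0 < r ∧ 0 < δ₀ ∧
      ∀ δ ∈ Set.Ioo 0 δ₀, ∀ x ∈ K, ∀ y ∈ K, dist x y < r →
        |rescaledCorrelator (criticalCorr 3)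
            (fun δ : ℝ => (criticalTwoPoint 3 (Pi.single 0 ⌊δ⁻¹⌋)) ^ (-(1/2:ℝ))) n δ (Λ • x) -
          rescaledCorrelator (criticalCorr 3)
            (fun δ : ℝ => (criticalTwoPoint 3 (Pi.single 0 ⌊δ⁻¹⌋)) ^ (-(1/2:ℝ))) n δ (Λ • y)| < ε

/-- verbatim copy of `Birth.PinningRatioBound` (stub 2 statement). -/
def PinningRatioBound : Prop :=
  ∀ Λ : ℝ, 1 ≤ Λ → ∃ C δ₀ : ℝ, 0 < δ₀ ∧ ∀ δ ∈ Set.Ioo 0 δ₀,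
    (criticalTwoPoint 3 (Pi.single 0 ⌊δ⁻¹⌋)) ^ (-(1/2:ℝ)) ≤
      C * (criticalTwoPoint 3 (Pi.single 0 ⌊(Λ * δ)⁻¹⌋)) ^ (-(1/2:ℝ))

/-! ### rpow bookkeeping: `a^{-1/2} ≤ C b^{-1/2}` versus `b ≤ C² a` for `a, b > 0` -/

theorem rpow_neg_half_eq {a : ℝ} (ha : 0 < a) : a ^ (-(1/2:ℝ)) = (Real.sqrt a)⁻¹ := by
  rw [Real.rpow_neg ha.le, Real.sqrt_eq_rpow]

theorem le_sq_mul_of_rpow_le {a b C : ℝ} (ha : 0 < a) (hb : 0 < b)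
    (h : a ^ (-(1/2:ℝ)) ≤ C * b ^ (-(1/2:ℝ))) : b ≤ C ^ 2 * a := by
  rw [rpow_neg_half_eq ha, rpow_neg_half_eq hb] at h
  have hsa : 0 < Real.sqrt a := Real.sqrt_pos.2 ha
  have hsb : 0 < Real.sqrt b := Real.sqrt_pos.2 hb
  have h1 : Real.sqrt b ≤ C * Real.sqrt a := by
    have h' : 1 / Real.sqrt a ≤ C / Real.sqrt b := by simpa [div_eq_mul_inv] using h
    rw [div_le_div_iff₀ hsa hsb] at h'
    linarith
  have h2 : Real.sqrt b ^ 2 ≤ (C * Real.sqrt a) ^ 2 := pow_le_pow_left₀ hsb.le h1 2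
  rwa [mul_pow, Real.sq_sqrt ha.le, Real.sq_sqrt hb.le] at h2

theorem rpow_le_of_le_sq_mul {a b C : ℝ} (ha : 0 < a) (hb : 0 < b) (hC : 0 ≤ C)
    (h : b ≤ C ^ 2 * a) : a ^ (-(1/2:ℝ)) ≤ C * b ^ (-(1/2:ℝ)) := by
  rw [rpow_neg_half_eq ha, rpow_neg_half_eq hb]
  have hsa : 0 < Real.sqrt a := Real.sqrt_pos.2 ha
  have hsb : 0 < Real.sqrt b := Real.sqrt_pos.2 hb
  have h1 : Real.sqrt b ≤ C * Real.sqrt a := by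
    have := Real.sqrt_le_sqrt h
    rwa [Real.sqrt_mul' _ ha.le, Real.sqrt_sq hC] at this
  have h' : 1 / Real.sqrt a ≤ C / Real.sqrt b := by
    rw [div_le_div_iff₀ hsa hsb]
    linarith
  simpa [div_eq_mul_inv] using h'

/-! ### stub 2 ⟺ item 6150 -/

/-- local shorthand: the axial critical two-point function on `ℕ`. -/
def g (k : ℕ) : ℝ := criticalTwoPoint 3 (Pi.single 0 (k : ℤ))

theorem g_pos (k : ℕ) : 0 < g k := criticalTwoPoint_pos3 _

theorem g_le_one (k : ℕ) : g k ≤ 1 := criticalTwoPoint_le_one' _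

theorem g_antitone {a b : ℕ} (h : a ≤ b) : g b ≤ g a :=
  Summit.CriticalPhenomena.Ising3DConformalLimit.MirrorHoelderCompactnessGlue.criticalTwoPoint_axis_antitone h

/-- **stub 2 ⟹ item 6150.** At `Λ = 2`, `δ = 1/(2n)`: `g(n) ≤ C² g(2n)` for `n ≥ N₀`; the finitely
many `n < N₀` are covered by positivity + axis monotonicity (`κ := min C⁻² g(2N₀)`). [folklore] -/
theorem twoPointDoubling_of_pinningRatioBound (h : PinningRatioBound) : TwoPointDoubling := by
  obtain ⟨C, δ₀, hδ₀, hC⟩ := h 2 (by norm_num)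
  obtain ⟨N₀, hN₀⟩ := exists_nat_gt δ₀⁻¹
  have hN₀pos : 0 < (N₀ : ℝ) := lt_trans (inv_pos.2 hδ₀) hN₀
  -- the bound at the scales n ≥ N₀
  have large : ∀ n : ℕ, N₀ ≤ n → g n ≤ C ^ 2 * g (2 * n) := by
    intro n hn
    have hn' : (N₀ : ℝ) ≤ n := by exact_mod_cast hn
    have hnpos : 0 < (n : ℝ) := lt_of_lt_of_le hN₀pos hn'
    set δ : ℝ := (2 * (n : ℝ))⁻¹ with hδ
    have hδpos : 0 < δ := by rw [hδ]; exact inv_pos.2 (mul_pos two_pos hnpos)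
    have hδlt : δ < δ₀ := by
      rw [hδ]
      calc (2 * (n : ℝ))⁻¹ ≤ (n : ℝ)⁻¹ := inv_anti₀ hnpos (by linarith)
        _ ≤ (N₀ : ℝ)⁻¹ := inv_anti₀ hN₀pos hn'
        _ < δ₀ := inv_lt_of_inv_lt₀ hδ₀ hN₀
    have key := hC δ ⟨hδpos, hδlt⟩
    have e1 : ⌊δ⁻¹⌋ = ((2 * n : ℕ) : ℤ) := by
      rw [hδ, inv_inv]
      have : (2 * (n : ℝ)) = (((2 * n : ℕ) : ℤ) : ℝ) := by push_cast; ring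
      rw [this, Int.floor_intCast]
    have e2 : ⌊(2 * δ)⁻¹⌋ = ((n : ℕ) : ℤ) := by
      have : (2 * δ)⁻¹ = ((n : ℤ) : ℝ) := by
        rw [hδ, mul_inv, inv_inv]; push_cast; field_simp
      rw [this, Int.floor_intCast]
    rw [e1, e2] at key
    exact le_sq_mul_of_rpow_le (g_pos _) (g_pos _) key
  -- C² > 0 from the bound at n = N₀ and positivity of g
  have hC2 : 0 < C ^ 2 := by
    have h1 := large N₀ le_rfl
    have hg := g_pos N₀
    have hg2 := g_pos (2 * N₀)
    nlinarith
  refine ⟨min (C ^ 2)⁻¹ (g (2 * N₀)), lt_min (inv_pos.2 hC2) (g_pos _), fun n hn => ?_⟩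
  have hcast : (2 : ℤ) * (n : ℤ) = ((2 * n : ℕ) : ℤ) := by push_cast; ring
  rw [hcast]
  show min (C ^ 2)⁻¹ (g (2 * N₀)) * g n ≤ g (2 * n)
  by_cases hnN : N₀ ≤ n
  · calc min (C ^ 2)⁻¹ (g (2 * N₀)) * g n ≤ (C ^ 2)⁻¹ * g n :=
          mul_le_mul_of_nonneg_right (min_le_left _ _) (g_pos _).le
      _ ≤ (C ^ 2)⁻¹ * (C ^ 2 * g (2 * n)) :=
          mul_le_mul_of_nonneg_left (large n hnN) (inv_pos.2 hC2).le
      _ = g (2 * n) := by rw [← mul_assoc, inv_mul_cancel₀ hC2.ne', one_mul]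
  · push Not at hnN
    calc min (C ^ 2)⁻¹ (g (2 * N₀)) * g n ≤ g (2 * N₀) * g n :=
          mul_le_mul_of_nonneg_right (min_le_right _ _) (g_pos _).le
      _ ≤ g (2 * N₀) * 1 := mul_le_mul_of_nonneg_left (g_le_one _) (g_pos _).le
      _ = g (2 * N₀) := mul_one _
      _ ≤ g (2 * n) := g_antitone (by omega)

/-- **item 6150 ⟹ stub 2.** With `m := ⌊(Λδ)⁻¹⌋ ≥ 1` and `M := ⌊δ⁻¹⌋ ≤ ⌈2Λ⌉ m`, comparable
scales (`criticalTwoPoint_axis_comparable`, landed) give `g(m) ≤ C g(M)`. [folklore] -/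
theorem pinningRatioBound_of_twoPointDoubling (hD : TwoPointDoubling) : PinningRatioBound := by
  intro Λ hΛ
  have hΛpos : 0 < Λ := lt_of_lt_of_le one_pos hΛ
  obtain ⟨C, hC, hcomp⟩ := criticalTwoPoint_axis_comparable hD (⌈2 * Λ⌉₊)
  refine ⟨Real.sqrt C, Λ⁻¹, inv_pos.2 hΛpos, fun δ hδ => ?_⟩
  have hδpos : 0 < δ := hδ.1
  have hΛδ : Λ * δ < 1 := by
    calc Λ * δ < Λ * Λ⁻¹ := mul_lt_mul_of_pos_left hδ.2 hΛpos
      _ = 1 := mul_inv_cancel₀ hΛpos.ne'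
  have hΛδpos : 0 < Λ * δ := mul_pos hΛpos hδpos
  -- the two floors as natural numbers
  have hm1 : (1 : ℝ) ≤ (Λ * δ)⁻¹ := (one_le_inv₀ hΛδpos).2 hΛδ.le
  set m : ℕ := ⌊(Λ * δ)⁻¹⌋₊ with hm
  set M : ℕ := ⌊δ⁻¹⌋₊ with hM
  have hm_floor : ⌊(Λ * δ)⁻¹⌋ = (m : ℤ) := by
    rw [hm, Int.natCast_floor_eq_floor (inv_nonneg.2 hΛδpos.le)]
  have hM_floor : ⌊δ⁻¹⌋ = (M : ℤ) := by
    rw [hM, Int.natCast_floor_eq_floor (inv_nonneg.2 hδpos.le)]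
  have hm_one : 1 ≤ m := by
    rw [hm]; exact Nat.le_floor (by exact_mod_cast hm1)
  -- M ≤ ⌈2Λ⌉ m
  have hMle : M ≤ ⌈2 * Λ⌉₊ * m := by
    have h1 : (M : ℝ) ≤ δ⁻¹ := Nat.floor_le (inv_nonneg.2 hδpos.le)
    have h2 : (Λ * δ)⁻¹ < m + 1 := Nat.lt_floor_add_one _
    have h3 : δ⁻¹ = Λ * (Λ * δ)⁻¹ := by field_simp
    have h4 : (m : ℝ) + 1 ≤ 2 * m := by
      have : (1 : ℝ) ≤ m := by exact_mod_cast hm_one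
      linarith
    have h5 : (M : ℝ) ≤ (⌈2 * Λ⌉₊ : ℝ) * m := by
      calc (M : ℝ) ≤ δ⁻¹ := h1
        _ = Λ * (Λ * δ)⁻¹ := h3
        _ ≤ Λ * (m + 1) := mul_le_mul_of_nonneg_left h2.le hΛpos.le
        _ ≤ Λ * (2 * m) := mul_le_mul_of_nonneg_left h4 hΛpos.le
        _ = (2 * Λ) * m := by ring
        _ ≤ (⌈2 * Λ⌉₊ : ℝ) * m := mul_le_mul_of_nonneg_right (Nat.le_ceil _) (by positivity)
    exact_mod_cast h5
  have key : g m ≤ C * g M := hcomp m M hm_one hMle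
  rw [hm_floor, hM_floor]
  show g M ^ (-(1/2:ℝ)) ≤ Real.sqrt C * g m ^ (-(1/2:ℝ))
  apply rpow_le_of_le_sq_mul (g_pos _) (g_pos _) (Real.sqrt_nonneg _)
  rwa [Real.sq_sqrt hC.le]

/-! ### stub 2 alone ⟹ the crux, and ⟹ stub 1 -/

/-- **stub 2 ALONE ⟹ crux 6152** (landed chain 6150 ⟹ 4658 ⟹ 6152). [folklore] -/
theorem nonSeparableModulus_of_pinningRatioBound (h : PinningRatioBound) : NonSeparableModulus :=
  stub_nonSeparableModulus_of_uniformRegularity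
    (ItemMaps.uniformRegularity_of_doubling (twoPointDoubling_of_pinningRatioBound h))

/-- **stub 2 ALONE ⟹ stub 1**: clause (b) of `UniformRegularity` (item 4658 ⟸ 6150, landed) on the
compact `Λ • K ⊆ NonCoincident`, with `r/Λ` in place of `r` (`Λ₀ := 1`). [folklore] -/
theorem coarseScaleModulus_of_pinningRatioBound (h : PinningRatioBound) : CoarseScaleModulus := by
  have hUR := ItemMaps.uniformRegularity_of_doubling (twoPointDoubling_of_pinningRatioBound h)
  intro n K hKs hK
  refine ⟨1, one_pos, fun Λ hΛ ε hε => ?_⟩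
  have hΛpos : 0 < Λ := lt_of_lt_of_le one_pos hΛ
  -- the dilated compact
  set K' : Set (Fin n → EuclideanSpace ℝ (Fin 3)) := (fun x => Λ • x) '' K with hK'
  have hK'c : IsCompact K' := hK.image (continuous_const_smul Λ)
  have hK's : K' ⊆ NonCoincident 3 n := by
    rintro _ ⟨x, hx, rfl⟩
    have hinj : Function.Injective x := hKs hx
    show Function.Injective (Λ • x)
    intro i j hij
    apply hinj
    have hij' : Λ • x i = Λ • x j := hij
    exact smul_right_injective _ hΛpos.ne' hij'
  obtain ⟨r, δ₀, hr, hδ₀, hb⟩ := (hUR.1 n K' hK's hK'c).2 ε hε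
  refine ⟨r / Λ, δ₀, div_pos hr hΛpos, hδ₀, fun δ hδ x hx y hy hxy => ?_⟩
  have hxK' : Λ • x ∈ K' := ⟨x, hx, rfl⟩
  have hyK' : Λ • y ∈ K' := ⟨y, hy, rfl⟩
  have hdist : dist (Λ • x) (Λ • y) < r := by
    rw [dist_smul₀, Real.norm_eq_abs, abs_of_pos hΛpos]
    calc Λ * dist x y < Λ * (r / Λ) := mul_lt_mul_of_pos_left hxy hΛpos
      _ = r := mul_div_cancel₀ _ hΛpos.ne'
  exact hb δ hδ _ hxK' _ hyK' hdist


/-! ### Against the REGISTERED names of `Lines/birth.lean` (imported): the copies above are the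
skeleton's statements verbatim (`Iff.rfl`), so everything transfers to the registered stubs. -/

open Summit.CriticalPhenomena.Ising3DConformalLimit.Cruxes.NonSeparableModulus in
theorem coarse_verbatim : Birth.CoarseScaleModulus ↔ CoarseScaleModulus := Iff.rfl

open Summit.CriticalPhenomena.Ising3DConformalLimit.Cruxes.NonSeparableModulus in
theorem pinning_verbatim : Birth.PinningRatioBound ↔ PinningRatioBound := Iff.rfl

open Summit.CriticalPhenomena.Ising3DConformalLimit.Cruxes.NonSeparableModulus in
/-- The registered stub 2 ALONE gives the crux (no `h1`). -/
theorem crux_of_registered_stub2 (h2 : Birth.Registered.stub_pinningRatioBound) :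
    NonSeparableModulus :=
  nonSeparableModulus_of_pinningRatioBound h2

open Summit.CriticalPhenomena.Ising3DConformalLimit.Cruxes.NonSeparableModulus in
/-- The registered stub 2 ALONE gives the registered stub 1. -/
theorem registered_stub1_of_registered_stub2 (h2 : Birth.Registered.stub_pinningRatioBound) :
    Birth.Registered.stub_coarseScaleModulus :=
  coarseScaleModulus_of_pinningRatioBound h2

open Summit.CriticalPhenomena.Ising3DConformalLimit.Cruxes.NonSeparableModulus in
/-- The registered stub 2 is EQUIVALENT to the route's open rank-2 crux item 6150. -/
theorem registered_stub2_iff_item6150 :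
    Birth.Registered.stub_pinningRatioBound ↔ TwoPointDoubling :=
  ⟨twoPointDoubling_of_pinningRatioBound, pinningRatioBound_of_twoPointDoubling⟩

end SkelVet6152R

end
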